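import Summits.MatrixMultiplication.MatrixMultiplication.Theorems.SoloInformedCwTwoCertificates
import Literature.Computability.AlgebraicComplexity.SkewCoppersmithWinogradProofs
import Literature.Computability.AlgebraicComplexity.BorderRankSkewCW
import Literature.Computability.AlgebraicComplexity.SchonhageRectangular

/-!
# The laser value bound for WEIGHTED Coppersmith–Winograd block structure; the doors `T_μ`

The tree's laser engine for the Coppersmith–Winograd block shape (`signedCw_kroneckerPow_blocks`,
`exists_restrictsTo_signedCw_kroneckerPow`, `omega_le_logb_of_laser_restrictions`; BCS Thm. (15.41)
run in `SkewCoppersmithWinogradProofs`) asks the three blocks to be SIGNED permutation matrices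
(`s x · s x = 1`). The signs enter only through the final normalisation `φ(x) ψ(y) · (weights) = 1`,
and the weights of a surviving block are products of per-coordinate factors; replacing `φ, ψ` by the
INVERSE weights, the same engine runs for WEIGHTED permutation blocks with arbitrary non-zero
weights (`weightedCw_kroneckerPow_blocks`, `exists_restrictsTo_weightedCw_kroneckerPow`): for such a
`T` on `Fin (q+1)³`, `q ≥ 2`, every real `ρ > R̃(T)` gives `ω(ℂ) ≤ log_q(4ρ³/27)`
(`omega_le_logb_of_asymptoticRank_weightedCw_lt`).

Application (`q = 2`): the one-parameter family of carriers
`T_μ = Σ_{j=1,2} (a₀ b_j c_j + a_j b₀ c_j) + (a₁ b₂ + μ a₂ b₁) c₀` (`hCarrier μ`, `c₀`-block the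
weighted permutation `H(μ)`): `T_{-1} = T_{skewcw,2}` literally (`hCarrier_neg_one`), `T_1 ≅ T_{cw,2}`,
and for `μ ≠ ±1` the `T_μ` are the generic carriers of this block shape (cosquare spectrum
`{μ, 1/μ}`), non-isomorphic to `T_{cw,2}` and `T_{skewcw,2}`. For EVERY `μ ≠ 0`:
**`R̃(T_μ) ≤ 3 ⇒ ω(ℂ) = 2`** (`matrixMultiplication_of_asymptoticRank_hCarrier_le_three`), a theorem
of the tree; and `3 ≤ R̃(T_μ)` (flattening rank), so each door is the equality `R̃(T_μ) = 3`.

[cite: BurgisserClausenShokrollahi1997, Thm. (15.41) (proof, pp. 381–383), Ex. 15.24(7)]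
[cite: ConnerGesmundoLandsbergVentura2022, §2.2]
-/

noncomputable section
open Filter Asymptotics Finset

namespace Summit.MatrixMultiplication.MatrixMultiplication.Theorems

open Literature.Computability.AlgebraicComplexity
open Literature.Barriers.MatrixMultiplication (flatteningRank_le_asymptoticRank
  one_le_tensorRank_of_ne_zero kroneckerPow_ne_zero)

namespace WeightedLaser

variable {K : Type} [Field K]

/-- **Laser method, combinatorial-restriction form, for WEIGHTED Coppersmith–Winograd block
structure**: as `signedCw_kroneckerPow_blocks`, with blocks `T(0,x+1,y+1) = [y = σ₁ x] s₁ x` etc.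
for arbitrary NON-ZERO weights `sᵢ x` (not necessarily signs); the normalising coefficients are the
inverse weights `φ(x) = (∏ s₂ ∏ s₃)⁻¹`, `ψ(y) = (∏ s₁)⁻¹`.
[cite: BurgisserClausenShokrollahi1997, Thm. 15.41 (proof, p. 381)] -/
theorem weightedCw_kroneckerPow_blocks (q m N : ℕ) (T : Fin (q + 1) → Fin (q + 1) → Fin (q + 1) → K)
    (σ₁ σ₂ σ₃ : Fin q → Fin q) (hσ₁ : Function.Injective σ₁) (hσ₂ : Function.Injective σ₂)
    (hσ₃ : Function.Injective σ₃) (s₁ s₂ s₃ : Fin q → K)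
    (hs₁ : ∀ x, s₁ x ≠ 0) (hs₂ : ∀ x, s₂ x ≠ 0) (hs₃ : ∀ x, s₃ x ≠ 0)
    (hT₁ : ∀ x y, T 0 x.succ y.succ = if y = σ₁ x then s₁ x else 0)
    (hT₂ : ∀ x y, T x.succ 0 y.succ = if y = σ₂ x then s₂ x else 0)
    (hT₃ : ∀ x y, T x.succ y.succ 0 = if y = σ₃ x then s₃ x else 0)
    (hsupp : ∀ i j k, T i j k ≠ 0 →
      (i = 0 ∧ j ≠ 0 ∧ k ≠ 0) ∨ (j = 0 ∧ i ≠ 0 ∧ k ≠ 0) ∨ (k = 0 ∧ i ≠ 0 ∧ j ≠ 0))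
    (Δ : Finset (Finset (Fin N) × Finset (Fin N) × Finset (Fin N)))
    (hcard : ∀ δ ∈ Δ, δ.1.card = m ∧ δ.2.1.card = m ∧ δ.2.2.card = m)
    (hpart : ∀ δ ∈ Δ, Disjoint δ.1 δ.2.1 ∧ Disjoint δ.1 δ.2.2 ∧ Disjoint δ.2.1 δ.2.2 ∧
      δ.1 ∪ δ.2.1 ∪ δ.2.2 = Finset.univ)
    (hfree : ∀ δ ∈ Δ, ∀ δ' ∈ Δ, ∀ δ'' ∈ Δ, Disjoint δ.1 δ'.2.1 → Disjoint δ.1 δ''.2.2 →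
      Disjoint δ'.2.1 δ''.2.2 → δ.1 ∪ δ'.2.1 ∪ δ''.2.2 = Finset.univ → δ = δ' ∧ δ' = δ'') :
    ∃ (F G H : Fin Δ.card × (Fin (q ^ m) × Fin (q ^ m)) → (Fin N → Fin (q + 1)))
      (φ ψ : Fin Δ.card × (Fin (q ^ m) × Fin (q ^ m)) → K),
      kroneckerTensor (unitTensor K Δ.card) (matMulTensor K (q ^ m) (q ^ m) (q ^ m)) =
        fun x y z => φ x * ψ y * kroneckerPow T N (F x) (G y) (H z) := by
  classical
  -- enumerate `Δ` and its blocks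
  let δ : Fin Δ.card → Finset (Fin N) × Finset (Fin N) × Finset (Fin N) :=
    fun s => (Δ.equivFin.symm s).1
  have hδmem : ∀ s, δ s ∈ Δ := fun s => (Δ.equivFin.symm s).2
  have hδinj : Function.Injective δ :=
    Subtype.val_injective.comp Δ.equivFin.symm.injective
  let eA : ∀ s, ↥(δ s).1 ≃ Fin m := fun s => Finset.equivFinOfCardEq (hcard _ (hδmem s)).1
  let eB : ∀ s, ↥(δ s).2.1 ≃ Fin m := fun s => Finset.equivFinOfCardEq (hcard _ (hδmem s)).2.1
  let eC : ∀ s, ↥(δ s).2.2 ≃ Fin m := fun s => Finset.equivFinOfCardEq (hcard _ (hδmem s)).2.2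
  -- `Fin (q^m)` as functions
  let f : Fin (q ^ m) → Fin m → Fin q := fun κ => finFunctionFinEquiv.symm κ
  have hf : ∀ κ κ' : Fin (q ^ m), f κ = f κ' ↔ κ = κ' := fun κ κ' =>
    finFunctionFinEquiv.symm.injective.eq_iff
  -- the index maps
  let F : Fin Δ.card × (Fin (q ^ m) × Fin (q ^ m)) → Fin N → Fin (q + 1) := fun x ρ =>
    if h : ρ ∈ (δ x.1).2.2 then (f x.2.1 (eC x.1 ⟨ρ, h⟩)).succ
    else if h' : ρ ∈ (δ x.1).2.1 then (f x.2.2 (eB x.1 ⟨ρ, h'⟩)).succ else 0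
  let G : Fin Δ.card × (Fin (q ^ m) × Fin (q ^ m)) → Fin N → Fin (q + 1) := fun y ρ =>
    if h : ρ ∈ (δ y.1).2.2 then (σ₃ (f y.2.1 (eC y.1 ⟨ρ, h⟩))).succ
    else if h' : ρ ∈ (δ y.1).1 then (f y.2.2 (eA y.1 ⟨ρ, h'⟩)).succ else 0
  let H : Fin Δ.card × (Fin (q ^ m) × Fin (q ^ m)) → Fin N → Fin (q + 1) := fun z ρ =>
    if h : ρ ∈ (δ z.1).1 then (σ₁ (f z.2.1 (eA z.1 ⟨ρ, h⟩))).succ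
    else if h' : ρ ∈ (δ z.1).2.1 then (σ₂ (f z.2.2 (eB z.1 ⟨ρ, h'⟩))).succ else 0
  -- the inverse weights
  let φ : Fin Δ.card × (Fin (q ^ m) × Fin (q ^ m)) → K := fun x =>
    ((∏ r, s₂ (f x.2.2 r)) * ∏ r, s₃ (f x.2.1 r))⁻¹
  let ψ : Fin Δ.card × (Fin (q ^ m) × Fin (q ^ m)) → K := fun y => (∏ r, s₁ (f y.2.2 r))⁻¹
  -- zero sets of the embedded indices
  have hF0 : ∀ x ρ, F x ρ = 0 ↔ ρ ∈ (δ x.1).1 := by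
    intro x ρ
    obtain ⟨hab, hac, hbc, hcov⟩ := hpart _ (hδmem x.1)
    simp only [F]
    constructor
    · intro h
      by_cases h1 : ρ ∈ (δ x.1).2.2
      · rw [dif_pos h1] at h; exact absurd h (Fin.succ_ne_zero _)
      · by_cases h2 : ρ ∈ (δ x.1).2.1
        · rw [dif_neg h1, dif_pos h2] at h; exact absurd h (Fin.succ_ne_zero _)
        · have := Finset.eq_univ_iff_forall.1 hcov ρ; simp only [Finset.mem_union] at this; tauto
    · intro h
      rw [dif_neg (Finset.disjoint_left.1 hac h), dif_neg (Finset.disjoint_left.1 hab h)]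
  have hG0 : ∀ y ρ, G y ρ = 0 ↔ ρ ∈ (δ y.1).2.1 := by
    intro y ρ
    obtain ⟨hab, hac, hbc, hcov⟩ := hpart _ (hδmem y.1)
    simp only [G]
    constructor
    · intro h
      by_cases h1 : ρ ∈ (δ y.1).2.2
      · rw [dif_pos h1] at h; exact absurd h (Fin.succ_ne_zero _)
      · by_cases h2 : ρ ∈ (δ y.1).1
        · rw [dif_neg h1, dif_pos h2] at h; exact absurd h (Fin.succ_ne_zero _)
        · have := Finset.eq_univ_iff_forall.1 hcov ρ; simp only [Finset.mem_union] at this; tauto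
    · intro h
      rw [dif_neg (Finset.disjoint_left.1 hbc h), dif_neg (Finset.disjoint_right.1 hab h)]
  have hH0 : ∀ z ρ, H z ρ = 0 ↔ ρ ∈ (δ z.1).2.2 := by
    intro z ρ
    obtain ⟨hab, hac, hbc, hcov⟩ := hpart _ (hδmem z.1)
    simp only [H]
    constructor
    · intro h
      by_cases h1 : ρ ∈ (δ z.1).1
      · rw [dif_pos h1] at h; exact absurd h (Fin.succ_ne_zero _)
      · by_cases h2 : ρ ∈ (δ z.1).2.1
        · rw [dif_neg h1, dif_pos h2] at h; exact absurd h (Fin.succ_ne_zero _)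
        · have := Finset.eq_univ_iff_forall.1 hcov ρ; simp only [Finset.mem_union] at this; tauto
    · intro h
      rw [dif_neg (Finset.disjoint_right.1 hac h), dif_neg (Finset.disjoint_right.1 hbc h)]
  refine ⟨F, G, H, φ, ψ, ?_⟩
  funext x y z
  obtain ⟨s, κ, ν⟩ := x
  obtain ⟨s', κ', μ⟩ := y
  obtain ⟨s'', μ', ν'⟩ := z
  rw [kroneckerTensor_apply, kroneckerPow_apply, unitTensor_apply]
  by_cases hs : s = s' ∧ s' = s''
  · -- a diagonal block: the matrix multiplication tensor, up to the weight `φ x ψ y`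
    obtain ⟨rfl, rfl⟩ := hs
    rw [if_pos ⟨rfl, rfl⟩, one_mul]
    obtain ⟨hab, hac, hbc, hcov⟩ := hpart _ (hδmem s)
    have key := signedCw_block_diag T σ₁ σ₂ σ₃ hσ₁ hσ₂ hσ₃ s₁ s₂ s₃ hT₁ hT₂ hT₃ hab hac hbc hcov
      (eA s) (eB s) (eC s) (f κ) (f ν) (f κ') (f μ) (f μ') (f ν')
      (F (s, κ, ν)) (G (s, κ', μ)) (H (s, μ', ν')) (fun ρ h => (hF0 _ ρ).2 h)
      (fun ρ h => by simp only [F]; rw [dif_pos h])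
      (fun ρ h => by simp only [F]; rw [dif_neg (Finset.disjoint_left.1 hbc h), dif_pos h])
      (fun ρ h => (hG0 _ ρ).2 h)
      (fun ρ h => by simp only [G]; rw [dif_pos h])
      (fun ρ h => by simp only [G]; rw [dif_neg (Finset.disjoint_left.1 hac h), dif_pos h])
      (fun ρ h => (hH0 _ ρ).2 h)
      (fun ρ h => by simp only [H]; rw [dif_pos h])
      (fun ρ h => by simp only [H]; rw [dif_neg (Finset.disjoint_right.1 hab h), dif_pos h])
    rw [key]
    simp only [matMulTensor]
    by_cases h : κ = κ' ∧ μ = μ' ∧ ν = ν'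
    · obtain ⟨rfl, rfl, rfl⟩ := h
      rw [if_pos ⟨rfl, rfl, rfl⟩, if_pos ⟨rfl, rfl, rfl⟩]
      have hA : (∏ r, s₁ (f μ r)) ≠ 0 := Finset.prod_ne_zero_iff.2 fun r _ => hs₁ _
      have hB : (∏ r, s₂ (f ν r)) ≠ 0 := Finset.prod_ne_zero_iff.2 fun r _ => hs₂ _
      have hC : (∏ r, s₃ (f κ r)) ≠ 0 := Finset.prod_ne_zero_iff.2 fun r _ => hs₃ _
      simp only [φ, ψ]
      field_simp
    · rw [if_neg h, if_neg fun h' => h ⟨(hf _ _).1 h'.1, (hf _ _).1 h'.2.1, (hf _ _).1 h'.2.2⟩,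
        mul_zero]
  · -- an off-diagonal block vanishes, by freeness of `Δ`
    rw [if_neg hs, zero_mul]
    by_cases hzero : kroneckerPow T N (F (s, κ, ν)) (G (s', κ', μ)) (H (s'', μ', ν')) = 0
    · rw [kroneckerPow_apply] at hzero
      rw [hzero, mul_zero]
    exfalso
    rw [kroneckerPow_apply] at hzero
    obtain ⟨h1, h2, h3, h4⟩ := signedCw_block_support T hsupp (F (s, κ, ν)) (G (s', κ', μ))
      (H (s'', μ', ν')) (hF0 _) (hG0 _) (hH0 _) hzero
    obtain ⟨e1, e2⟩ := hfree _ (hδmem s) _ (hδmem s') _ (hδmem s'') h1 h2 h3 h4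
    exact hs ⟨hδinj e1, hδinj e2⟩

/-- **Laser restriction for weighted Coppersmith–Winograd block structure**: for `m ≥ 1`,
`T^{⊠3m} ≥ ⟨p⟩ ⊗ ⟨q^m,q^m,q^m⟩` with `p` the size of a free balanced diagonal
(`exists_free_balanced_diagonal`). [cite: BurgisserClausenShokrollahi1997, Thm. 15.41 (proof)] -/
theorem exists_restrictsTo_weightedCw_kroneckerPow (q m : ℕ) (hm : 1 ≤ m)
    (T : Fin (q + 1) → Fin (q + 1) → Fin (q + 1) → K)
    (σ₁ σ₂ σ₃ : Fin q → Fin q) (hσ₁ : Function.Injective σ₁) (hσ₂ : Function.Injective σ₂)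
    (hσ₃ : Function.Injective σ₃) (s₁ s₂ s₃ : Fin q → K)
    (hs₁ : ∀ x, s₁ x ≠ 0) (hs₂ : ∀ x, s₂ x ≠ 0) (hs₃ : ∀ x, s₃ x ≠ 0)
    (hT₁ : ∀ x y, T 0 x.succ y.succ = if y = σ₁ x then s₁ x else 0)
    (hT₂ : ∀ x y, T x.succ 0 y.succ = if y = σ₂ x then s₂ x else 0)
    (hT₃ : ∀ x y, T x.succ y.succ 0 = if y = σ₃ x then s₃ x else 0)
    (hsupp : ∀ i j k, T i j k ≠ 0 →
      (i = 0 ∧ j ≠ 0 ∧ k ≠ 0) ∨ (j = 0 ∧ i ≠ 0 ∧ k ≠ 0) ∨ (k = 0 ∧ i ≠ 0 ∧ j ≠ 0)) :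
    ∃ p : ℕ, (3 * m).choose m * rothNumberNat (3 * (2 * m).choose m) ≤ 288 * (2 * m).choose m * p ∧
      TensorRestrictsTo (kroneckerPow T (3 * m))
        (kroneckerTensor (unitTensor K p) (matMulTensor K (q ^ m) (q ^ m) (q ^ m))) := by
  classical
  obtain ⟨Δ, hcard, hpart, hfree, hsize⟩ := exists_free_balanced_diagonal m hm
  obtain ⟨F, G, H, φ, ψ, hFGH⟩ := weightedCw_kroneckerPow_blocks q m (3 * m) T σ₁ σ₂ σ₃ hσ₁ hσ₂
    hσ₃ s₁ s₂ s₃ hs₁ hs₂ hs₃ hT₁ hT₂ hT₃ hsupp Δ hcard hpart hfree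
  refine ⟨Δ.card, hsize, ?_⟩
  rw [hFGH]
  exact tensorRestrictsTo_precomp_mul _ F G H φ ψ

/-- **Rank form** over `ℂ`: for `q ≥ 2`, `k ≥ 1`, `ω ≤ log_q((4/27) · R(T^{⊠k})^{3/k})` (the proof
of `CGLV2022_skewCw_rank_form_holds`, weighted). [cite: BurgisserClausenShokrollahi1997, Thm. (15.41)] -/
theorem omega_le_logb_rank_form_weightedCw (q : ℕ) (hq : 2 ≤ q)
    (T : Fin (q + 1) → Fin (q + 1) → Fin (q + 1) → ℂ) (hT0 : T ≠ 0)
    (σ₁ σ₂ σ₃ : Fin q → Fin q) (hσ₁ : Function.Injective σ₁) (hσ₂ : Function.Injective σ₂)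
    (hσ₃ : Function.Injective σ₃) (s₁ s₂ s₃ : Fin q → ℂ)
    (hs₁ : ∀ x, s₁ x ≠ 0) (hs₂ : ∀ x, s₂ x ≠ 0) (hs₃ : ∀ x, s₃ x ≠ 0)
    (hT₁ : ∀ x y, T 0 x.succ y.succ = if y = σ₁ x then s₁ x else 0)
    (hT₂ : ∀ x y, T x.succ 0 y.succ = if y = σ₂ x then s₂ x else 0)
    (hT₃ : ∀ x y, T x.succ y.succ 0 = if y = σ₃ x then s₃ x else 0)
    (hsupp : ∀ i j k, T i j k ≠ 0 →
      (i = 0 ∧ j ≠ 0 ∧ k ≠ 0) ∨ (j = 0 ∧ i ≠ 0 ∧ k ≠ 0) ∨ (k = 0 ∧ i ≠ 0 ∧ j ≠ 0))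
    (k : ℕ) (hk : 1 ≤ k) :
    omega ℂ ≤ Real.logb q ((4 / 27) * ((tensorRank (kroneckerPow T k) : ℝ) ^ ((3 : ℝ) / k))) := by
  set r : ℕ := tensorRank (kroneckerPow T k) with hr
  have hr1 : 1 ≤ r := one_le_tensorRank_of_ne_zero (kroneckerPow_ne_zero hT0 k)
  have hr0 : (0 : ℝ) < r := by exact_mod_cast hr1
  have hr1' : (1 : ℝ) ≤ r := by exact_mod_cast hr1
  set ρ : ℝ := (r : ℝ) ^ ((k : ℝ)⁻¹) with hρ
  have hρ1 : 1 ≤ ρ := Real.one_le_rpow hr1' (inv_nonneg.2 (Nat.cast_nonneg _))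
  have hρ0 : 0 < ρ := by linarith
  set M : ℕ := max 1 (tensorRank (kroneckerPow T 1)) with hM
  have hyp : ∀ ε : ℝ, 0 < ε →
      (fun N : ℕ => (tensorRank (kroneckerPow T N) : ℝ)) =O[atTop]
        fun N : ℕ => ρ ^ ((1 + ε) * N) := by
    intro ε hε
    refine Asymptotics.IsBigO.of_bound ((M : ℝ) ^ k) (Filter.Eventually.of_forall fun N => ?_)
    rw [Real.norm_of_nonneg (Nat.cast_nonneg _),
      Real.norm_of_nonneg (Real.rpow_pos_of_pos hρ0 _).le]
    calc (tensorRank (kroneckerPow T N) : ℝ) ≤ (M : ℝ) ^ k * ρ ^ N :=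
          tensorRank_kroneckerPow_le_of_ne_zero T hT0 k hk N
      _ ≤ (M : ℝ) ^ k * ρ ^ ((1 + ε) * N) := by
          refine mul_le_mul_of_nonneg_left ?_ (by positivity)
          calc ρ ^ N = ρ ^ (N : ℝ) := (Real.rpow_natCast ρ N).symm
            _ ≤ ρ ^ ((1 + ε) * N) := Real.rpow_le_rpow_of_exponent_le hρ1
                (le_mul_of_one_le_left (Nat.cast_nonneg N) (by linarith))
  have h := omega_le_logb_of_laser_restrictions T q hq ρ hρ0
    (fun m hm => exists_restrictsTo_weightedCw_kroneckerPow q m hm T σ₁ σ₂ σ₃ hσ₁ hσ₂ hσ₃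
      s₁ s₂ s₃ hs₁ hs₂ hs₃ hT₁ hT₂ hT₃ hsupp) hyp
  have hρ3 : ρ ^ 3 = (r : ℝ) ^ ((3 : ℝ) / k) := by
    rw [hρ, ← Real.rpow_natCast, ← Real.rpow_mul hr0.le]
    congr 1
    push_cast
    ring
  have e : 4 * ρ ^ 3 / 27 = 4 / 27 * (r : ℝ) ^ ((3 : ℝ) / k) := by rw [hρ3]; ring
  rwa [e] at h

/-- **Asymptotic-rank form**: for `q ≥ 2` and every real `ρ > R̃(T)`, `ω(ℂ) ≤ log_q(4ρ³/27)`
(rank form at a power with `R(T^{⊠N₀}) ≤ ρ^{N₀}`). [cite: BurgisserClausenShokrollahi1997, Ex. 15.24(7)] -/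
theorem omega_le_logb_of_asymptoticRank_weightedCw_lt (q : ℕ) (hq : 2 ≤ q)
    (T : Fin (q + 1) → Fin (q + 1) → Fin (q + 1) → ℂ) (hT0 : T ≠ 0)
    (σ₁ σ₂ σ₃ : Fin q → Fin q) (hσ₁ : Function.Injective σ₁) (hσ₂ : Function.Injective σ₂)
    (hσ₃ : Function.Injective σ₃) (s₁ s₂ s₃ : Fin q → ℂ)
    (hs₁ : ∀ x, s₁ x ≠ 0) (hs₂ : ∀ x, s₂ x ≠ 0) (hs₃ : ∀ x, s₃ x ≠ 0)
    (hT₁ : ∀ x y, T 0 x.succ y.succ = if y = σ₁ x then s₁ x else 0)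
    (hT₂ : ∀ x y, T x.succ 0 y.succ = if y = σ₂ x then s₂ x else 0)
    (hT₃ : ∀ x y, T x.succ y.succ 0 = if y = σ₃ x then s₃ x else 0)
    (hsupp : ∀ i j k, T i j k ≠ 0 →
      (i = 0 ∧ j ≠ 0 ∧ k ≠ 0) ∨ (j = 0 ∧ i ≠ 0 ∧ k ≠ 0) ∨ (k = 0 ∧ i ≠ 0 ∧ j ≠ 0))
    {ρ : ℝ} (hρ : asymptoticRank T < ρ) :
    omega ℂ ≤ Real.logb q (4 * ρ ^ 3 / 27) := by
  have hq1 : (1 : ℝ) < q := by exact_mod_cast hq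
  have hε : 0 < ρ - asymptoticRank T := sub_pos.2 hρ
  have hρ0 : 0 < ρ := lt_of_le_of_lt (asymptoticRank_nonneg _) hρ
  obtain ⟨N₀, hN₀, hpow⟩ := exists_tensorRank_kroneckerPow_mul_le T hε
  have hR : (tensorRank (kroneckerPow T N₀) : ℝ) ≤ ρ ^ N₀ := by
    have h := hpow 1
    rw [mul_one, add_sub_cancel] at h
    exact h
  have hR1 : (1 : ℝ) ≤ tensorRank (kroneckerPow T N₀) := by
    exact_mod_cast one_le_tensorRank_of_ne_zero (kroneckerPow_ne_zero hT0 N₀)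
  have hR0 : (0 : ℝ) ≤ tensorRank (kroneckerPow T N₀) := by linarith
  have h := omega_le_logb_rank_form_weightedCw q hq T hT0 σ₁ σ₂ σ₃ hσ₁ hσ₂ hσ₃ s₁ s₂ s₃ hs₁ hs₂ hs₃
    hT₁ hT₂ hT₃ hsupp N₀ hN₀
  have hpos : (0 : ℝ) < (4 / 27) * (tensorRank (kroneckerPow T N₀) : ℝ) ^ ((3 : ℝ) / N₀) :=
    mul_pos (by norm_num) (Real.rpow_pos_of_pos (by linarith) _)
  refine h.trans (Real.logb_le_logb_of_le hq1 hpos ?_)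
  have hexp : (tensorRank (kroneckerPow T N₀) : ℝ) ^ ((3 : ℝ) / N₀) ≤ ρ ^ 3 := by
    calc (tensorRank (kroneckerPow T N₀) : ℝ) ^ ((3 : ℝ) / N₀)
        ≤ (ρ ^ N₀) ^ ((3 : ℝ) / N₀) := Real.rpow_le_rpow hR0 hR (by positivity)
      _ = ρ ^ 3 := by
          have hN0 : (N₀ : ℝ) ≠ 0 := by exact_mod_cast (by omega : N₀ ≠ 0)
          rw [← Real.rpow_natCast, ← Real.rpow_mul hρ0.le, ← Real.rpow_natCast]
          congr 1
          push_cast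
          field_simp
  linarith


/-- The carrier `T_μ` of Coppersmith–Winograd block shape with `c₀`-block
`H(μ) = a₁ b₂ + μ a₂ b₁` (and identity `a₀`-, `b₀`-blocks). `T_{-1} = T_{skewcw,2}`; `T_1 ≅ T_{cw,2}`.
[cite: ConnerGesmundoLandsbergVentura2022, eq. (3)] -/
def hCarrier (μ : ℂ) : Fin 3 → Fin 3 → Fin 3 → ℂ := fun i j k =>
  if (i = 0 ∧ j = k ∧ j ≠ 0) ∨ (j = 0 ∧ i = k ∧ i ≠ 0) then 1
  else if k = 0 ∧ i = 1 ∧ j = 2 then 1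
  else if k = 0 ∧ i = 2 ∧ j = 1 then μ
  else 0

/-- `T_{-1} = T_{skewcw,2}` literally. [cite: ConnerGesmundoLandsbergVentura2022, eq. (3)] -/
theorem hCarrier_neg_one : hCarrier (-1) = skewCwTensor ℂ 1 := by
  funext i j k
  fin_cases i <;> fin_cases j <;> fin_cases k <;> simp [hCarrier, skewCwTensor]

/-- `T_μ ≠ 0` (entry `1` at `(0,1,1)`). -/
theorem hCarrier_ne_zero (μ : ℂ) : hCarrier μ ≠ 0 := by
  intro h
  have := congrFun (congrFun (congrFun h 0) 1) 1
  simp [hCarrier] at this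
/-- **The value bound for every `T_μ`, `μ ≠ 0`**: `R̃(T_μ) < ρ ⇒ ω(ℂ) ≤ log₂(4ρ³/27)`.
[cite: BurgisserClausenShokrollahi1997, Thm. (15.41), Ex. 15.24(7)] -/
theorem omega_le_logb_of_asymptoticRank_hCarrier_lt {μ : ℂ} (hμ : μ ≠ 0) {ρ : ℝ}
    (hρ : asymptoticRank (hCarrier μ) < ρ) : omega ℂ ≤ Real.logb 2 (4 * ρ ^ 3 / 27) := by
  have h := omega_le_logb_of_asymptoticRank_weightedCw_lt 2 le_rfl (hCarrier μ) (hCarrier_ne_zero μ)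
    id id ![1, 0] (fun _ _ h => h) (fun _ _ h => h) (by decide) (fun _ => 1) (fun _ => 1) ![1, μ]
    (fun _ => one_ne_zero) (fun _ => one_ne_zero)
    (fun x => by fin_cases x <;> simp [hμ]) ?_ ?_ ?_ ?_ hρ
  · simpa using h
  · intro x y; fin_cases x <;> fin_cases y <;> simp [hCarrier]
  · intro x y; fin_cases x <;> fin_cases y <;> simp [hCarrier]
  · intro x y; fin_cases x <;> fin_cases y <;> simp [hCarrier]
  · intro i j k h
    simp only [hCarrier] at h
    split_ifs at h with h1 h2 h3
    · rcases h1 with ⟨hi, hjk, hj⟩ | ⟨hj, hik, hi⟩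
      · exact Or.inl ⟨hi, hj, hjk ▸ hj⟩
      · exact Or.inr (Or.inl ⟨hj, hi, hik ▸ hi⟩)
    · obtain ⟨hk, hi, hj⟩ := h2
      exact Or.inr (Or.inr ⟨hk, by rw [hi]; decide, by rw [hj]; decide⟩)
    · obtain ⟨hk, hi, hj⟩ := h3
      exact Or.inr (Or.inr ⟨hk, by rw [hi]; decide, by rw [hj]; decide⟩)
    · exact absurd rfl h

/-- **The door for every carrier `T_μ`**: for `μ ≠ 0`, `R̃(T_μ) ≤ 3 ⇒ ω(ℂ) = 2` — a one-parameter
family of sufficient conditions for the summit, each a statement about ONE `3 × 3 × 3` tensor,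
containing the skew door (`μ = -1`) and, up to isomorphism of the carrier, D1 (`μ = 1`).
[cite: BurgisserClausenShokrollahi1997, Thm. (15.41), Ex. 15.24(7)]
[cite: ConnerGesmundoLandsbergVentura2022, §2.2] -/
theorem matrixMultiplication_of_asymptoticRank_hCarrier_le_three {μ : ℂ} (hμ : μ ≠ 0)
    (h : asymptoticRank (hCarrier μ) ≤ 3) : _root_.MatrixMultiplication := by
  refine _root_.MatrixMultiplication_iff.2 (le_antisymm ?_ (omega_two_le ℂ))
  refine le_of_forall_pos_le_add fun η hη => ?_
  have h2 : (1 : ℝ) < (2 : ℝ) ^ (η / 3) := Real.one_lt_rpow (by norm_num) (by positivity)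
  have hρ3 : (3 : ℝ) < 3 * (2 : ℝ) ^ (η / 3) := by linarith
  have hA := omega_le_logb_of_asymptoticRank_hCarrier_lt hμ (lt_of_le_of_lt h hρ3)
  have hcube : (3 * (2 : ℝ) ^ (η / 3)) ^ 3 = 27 * (2 : ℝ) ^ η := by
    rw [mul_pow]
    have e : ((2 : ℝ) ^ (η / 3)) ^ 3 = (2 : ℝ) ^ η := by
      rw [← Real.rpow_natCast, ← Real.rpow_mul (by norm_num : (0 : ℝ) ≤ 2)]
      congr 1
      push_cast
      ring
    rw [e]
    norm_num
  have hval : Real.logb 2 (4 * (3 * (2 : ℝ) ^ (η / 3)) ^ 3 / 27) = 2 + η := by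
    rw [hcube]
    have e : (4 : ℝ) * (27 * (2 : ℝ) ^ η) / 27 = (2 : ℝ) ^ ((2 : ℝ) + η) := by
      rw [Real.rpow_add (by norm_num : (0 : ℝ) < 2), Real.rpow_two]
      ring
    rw [e, Real.logb_rpow (by norm_num) (by norm_num)]
  rw [hval] at hA
  exact hA

/-- **Lower window for the family**: `3 ≤ R̃(T_μ)` for every `μ` (the three `a`-slices are
linearly independent: flattening rank `3`). [cite: ChristandlVranaZuiddam2023, Example 1.4] -/
theorem three_le_asymptoticRank_hCarrier (μ : ℂ) : (3 : ℝ) ≤ asymptoticRank (hCarrier μ) := by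
  have hli : LinearIndependent ℂ (xSlices (hCarrier μ)) := by
    rw [Fintype.linearIndependent_iff]
    intro g hg a
    have hev : ∀ b c : Fin 3, (∑ i, g i * hCarrier μ i b c) = 0 := by
      intro b c
      have := congrFun hg (b, c)
      simpa [Finset.sum_apply, Pi.smul_apply, xSlices_apply, smul_eq_mul] using this
    fin_cases a
    · have h1 := hev 1 1
      rw [Fin.sum_univ_three] at h1
      simpa [hCarrier] using h1
    · have h1 := hev 0 1
      rw [Fin.sum_univ_three] at h1
      simpa [hCarrier] using h1
    · have h1 := hev 0 2
      rw [Fin.sum_univ_three] at h1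
      simpa [hCarrier] using h1
  have hflat : flatteningRank (hCarrier μ) = 3 := by
    unfold flatteningRank
    rw [finrank_span_eq_card hli, Fintype.card_fin]
  have h := flatteningRank_le_asymptoticRank (hCarrier μ)
  rw [hflat] at h
  exact_mod_cast h

end WeightedLaser

end Summit.MatrixMultiplication.MatrixMultiplication.Theorems

end
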